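import Summits.QuantumFields.BalabanUV.T4Continuum.Support.AveragingDeficitDualResidual
import Summits.QuantumFields.BalabanUV.T4Continuum.Support.NE3EnergyHessContTwoTerm
import HarnessLib

/-!
# T⁴ programme, node NE3 — row E-RES♯, sub-row R♯4 «EXACTNESS BY DEFECT CORRECTION»: every APPROXIMATE lift `ψ₀` of a
# coarse direction `φ` through Bałaban's linearised average is corrected to an EXACT lift `ψ₀ + η` by NE3-R2's periodic face
# lift `η` of the push defect, with `η` bounded by the defect (kernel glue, no new analytic estimate)

NE3 formalisation swarm, LEAF PROVER 02 (unit `b2b-balaban-t4-ne3-formalise-leaf-02`, gen 4; cell `pub-balaban`); row E-RES♯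
of the owner's skeleton `SKELETON-NE3-P1.md` v1.10 §4b, owner CUT «E-RES♯ INTO ROWS» (journal 2026-08-20T14:09Z) R♯4:
«`pushDir` is additive in ψ (`AveragingDeficitPushForwardLinear`), so `ψ := dsliceLift φ + η` with η := `exists_lift_periodic`
applied to the defect `δ := φ − pushDir L V (dsliceLift φ)∘(L•)` is an EXACT lift with `‖η‖ ≤ 2L^d‖δ‖`,
`√curlSq_V η ≤ √(8#Pl)·√dirSq η` — a-weighted, harmless».  SHAPE `t4/formal/NE3/Statements/E-RES-R4-SHAPE-v1.md`.

GENERIC CUT.  The row is typed for ANY approximate lift `ψ₀` (skew, `(L·M)`-periodic): the PUSH DEFECT is the explicit coarse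
function `y κ ↦ φ y κ − cpush L V ψ₀ y κ` (`AveragingDeficitMultiLevelPrep.cpush L V ψ₀ y κ = pushDir L V ψ₀ (L•y) κ`); the
assembly row R♯5 instantiates `ψ₀ :=` the dressed slice lift of R♯3a with R♯3a∕R♯3b's bounds.  0 `def`, 0 sorry.

CONTENT ([folklore]; unitary `(L·M)`-periodic `V` in `SmallField V a` with `liftSmall d L·a ≤ 1`; `φ` skew, `M`-periodic;
`ψ₀` skew, `(L·M)`-periodic):
* §1 `loop_le_of_liftSmall` (the B7 loop smallness `‖W_{c,x} − 1‖ ≤ 1∕32` at every bond from `liftSmall·a ≤ 1`, by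
  `B7Prop2Explicit.norm_Wcx_sub_one_le`), `isPeriodicDir_defect`, `defect_mem_skewAdjoint`;
* §2 **`exists_correction`** — `∃ η`, face-supported, skew, `(L·M)`-periodic, with `pushDir L V (ψ₀ + η) (L•y) κ = φ y κ` EXACTLY and
  `‖η (faceSite L y κ) κ‖ ≤ 2L^d·‖φ y κ − cpush L V ψ₀ y κ‖` (`AveragingDeficitLiftPeriodic.exists_lift_periodic` on the defect,
  `AveragingDeficitPushForwardLinear.pushDir_add`);
* §3 the correction's norms over one period against the defect's coarse norms `coarseSq M δ`, `coarseL1 M δ`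
  (`dirSq_faceSupported_eq`, `dirL1_faceSupported_eq`, `curlSq_le_periodic`, `curlL1_le_periodic` BY NAME);
* §4 Minkowski ∕ triangle bookkeeping for `ψ₀ + η` (`NE3EnergyHessBilin.curlAt_add`, `NE3EnergyHessContTwoTerm.sqrt_sum_sq_add_le`);
* §5 END **`exists_exact_lift_of_approx`** (one `∃` packaging §2–§4) and the a-WEIGHTED COROLLARY **`exists_exact_lift_of_pushDefect`**
  under R♯3a's HYPOTHESIS SHAPE `∀ y κ, ‖φ y κ − cpush L V ψ₀ y κ‖ ≤ C₁·a·‖φ y κ‖` — the «a-weighted, harmless» terms that R♯5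
  feeds to `AveragingDeficitResidualPairing.residualPairing_torus`.

RELATION TO THE TREE (finding F-ne3leaf01g4-1, leaf-01-g4, 2026-08-20T14:15Z): for the SPECIFIC dressed lift of the cut the
exactness is ALSO available without the correction detour — `SpreadLift.pushDir_spreadInverse` (leaf-01 g3, S6-Y7 (c)) gives an
exact cross-supported lift `spreadInverse` with `norm_spreadInverse_sub_spreadLift_le`; this file is the GENERIC route (any `ψ₀`,
face-lift correction) and supplies the Minkowski ∕ one-period bookkeeping in the (RES♯) currency (`curlSq`, `dirSq`, `dirL1`,
`curlL1` against `coarseSq` ∕ `coarseL1`) that the assembly R♯5 needs on either route.  No statement of `SpreadLift*` is restated.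

HONEST FRAMING.  Kernel glue (linear algebra of the push-forward + NE3-R2's lift BY NAME) at ONE configuration on ONE lattice pair;
no minimiser, no two runs, no rate; (RES♯) is NOT proved by this row (needs R♯2, R♯3a∕b, R♯5); NE3 NOT proved; spine PROVED 0∕9;
finite T⁴ rung (B)+1 — NOT infinite volume, NOT mass gap, NOT `BetaPertH`, NOT Clay.  HONEST DEPENDENCY: continuum YM on T⁴ ⇐
BetaPertH ∧ nine spine estimates (0/9 proved); BetaPertH ⇐ (D1) ∧ (D4) ∧ CAP+tail; G-an2-4 gates asym, D1 and NE2/3/4.  ABSOLUTE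
RULE kept: no printed sentence is a hypothesis (context only: [Balaban1985Averaging] (42) p.23, (44)–(45) p.24); no `def … : Prop`.
PLACEMENT: our work, `Summits/QuantumFields/BalabanUV/`; imports accepted modules only.
-/

set_option autoImplicit false

open scoped BigOperators Matrix Matrix.Norms.L2Operator
open NormedSpace Finset

namespace Summit.QuantumFields.BalabanUV.T4Continuum.NE3LiftDefectCorrection

open Literature.MathematicalPhysics.QuantumFieldTheory.Balaban1983to89
open B7Prop1Explicit B7Prop2Explicit MatrixLog UnitaryModel
open T4AveragingDeficitWall hiding Site Plane Plaq Bond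
open T4AveragingDeficitWallBoundary (IsPeriodicCfg periodBox)
open AveragingDeficitTransport (mem_U1_of_unitary)
open AveragingDeficitPeriodicCounting (IsPeriodicDir natCast_mul_period)
open AveragingDeficitResidualPairing (pushDir pushDir_mem_skewAdjoint)
open AveragingDeficitPushForwardLinear (pushDir_add)
open AveragingDeficitFaceWords (faceSite FaceSupported)
open AveragingDeficitFaceLift (liftSmall)
open AveragingDeficitLiftPeriodic (exists_lift_periodic)
open AveragingDeficitDualResidual (coarseSq coarseL1 coarseSq_nonneg coarseL1_nonneg dirSq_faceSupported_eq
  dirL1_faceSupported_eq curlSq_le_periodic curlL1_le_periodic)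
open AveragingDeficitMultiLevelPrep (cpush isPeriodicDir_cpush)
open NE3HessShapes (plaqsOf curlSq_eq_sum_plaqsOf)
open NE3EnergyHessBilin (curlAt_add)
open NE3EnergyHessContTwoTerm (sqrt_sum_sq_add_le)

noncomputable section

variable {d : ℕ} {n : Type*} [Fintype n] [DecidableEq n] [Nonempty n]

/-! ## §1 The loop smallness at every bond; the push defect is periodic and skew -/

/-- **THE B7 LOOP SMALLNESS FROM `liftSmall·a ≤ 1`**: for unitary `V` in `SmallField V a` with `liftSmall d L·a ≤ 1` (`L ≥ 1`),
every loop variable of (42) is within `1∕32` of `1`: `‖W_{c,x} − 1‖ ≤ 1∕32` (B7 p. 25 TYPE via `norm_Wcx_sub_one_le`: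
`≤ 16(d+1)(d+4)L²a ≤ 1∕32` since `liftSmall ≥ 512(d+1)(d+4)L²`). [folklore] -/
theorem loop_le_of_liftSmall {L : ℕ} (hL : 1 ≤ L) {V : Site d → Fin d → (Matrix n n ℂ)ˣ} (hV : IsUnitaryCfg V) {a : ℝ}
    (ha : 0 ≤ a) (hsmall : liftSmall d L * a ≤ 1) (hVa : SmallField V a) (q : Site d) (κ : Fin d) (r : Fin d → Fin L) :
    ‖((Wcx L V q κ (boxVec L r) : (Matrix n n ℂ)ˣ) : Matrix n n ℂ) - 1‖ ≤ 1 / 32 := by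
  have hL1 : (1 : ℝ) ≤ L := by exact_mod_cast hL
  have hLd : (1 : ℝ) ≤ (L : ℝ) ^ d := one_le_pow₀ hL1
  unfold liftSmall at hsmall
  have hpow : (L : ℝ) ^ (d + 2) = (L : ℝ) ^ d * (L : ℝ) ^ 2 := by ring
  rw [hpow] at hsmall
  have h0 : 0 ≤ ((d : ℝ) + 1) * ((d : ℝ) + 4) * (L : ℝ) ^ 2 * a := by positivity
  have h512 : 512 * (d + 1) * (d + 4) * (L : ℝ) ^ 2 * a ≤ 1 := by nlinarith
  have hU : ∀ (x : Site d) (μ : Fin d), V x μ ∈ U1 (Matrix n n ℂ) := fun x μ => mem_U1_of_unitary (hV x μ)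
  have h := norm_Wcx_sub_one_le L hL V hU ha h512 hVa q κ r
  have h16 : 2 * (8 * (d + 1) * (d + 4) * (L : ℝ) ^ 2 * a) ≤ 1 / 32 := by nlinarith
  exact h.trans h16

omit [Nonempty n] in
/-- The push defect `φ − cpush L V ψ₀` of an `(L·M)`-periodic approximate lift of an `M`-periodic datum is `M`-periodic. [folklore] -/
theorem isPeriodicDir_defect {L M : ℕ} {V : Site d → Fin d → (Matrix n n ℂ)ˣ} (hVP : IsPeriodicCfg V ((L : ℤ) * M))
    {φ ψ₀ : Site d → Fin d → Matrix n n ℂ} (hφP : IsPeriodicDir φ (M : ℤ)) (hψ₀P : IsPeriodicDir ψ₀ ((L : ℤ) * M)) :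
    IsPeriodicDir (fun y κ => φ y κ - cpush L V ψ₀ y κ) (M : ℤ) := by
  intro y j κ
  have h1 := hφP y j κ
  have h2 := isPeriodicDir_cpush L M hVP hψ₀P y j κ
  simp only [h1, h2]

/-- The push defect of a skew approximate lift of a skew datum is skew (unitary `V`, loop smallness). [folklore] -/
theorem defect_mem_skewAdjoint {L : ℕ} (hL : 1 ≤ L) {V : Site d → Fin d → (Matrix n n ℂ)ˣ} (hV : IsUnitaryCfg V) {a : ℝ}
    (ha : 0 ≤ a) (hsmall : liftSmall d L * a ≤ 1) (hVa : SmallField V a) {φ ψ₀ : Site d → Fin d → Matrix n n ℂ}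
    (hφs : ∀ (y : Site d) (κ : Fin d), φ y κ ∈ skewAdjoint (Matrix n n ℂ)) (hψ₀s : IsSkewDir ψ₀) (y : Site d) (κ : Fin d) :
    φ y κ - cpush L V ψ₀ y κ ∈ skewAdjoint (Matrix n n ℂ) := by
  refine (skewAdjoint (Matrix n n ℂ)).sub_mem (hφs y κ) ?_
  exact pushDir_mem_skewAdjoint L hV hψ₀s _ κ fun r =>
    (loop_le_of_liftSmall hL hV ha hsmall hVa _ κ r).trans_lt (by norm_num)

/-! ## §2 The correction: NE3-R2's periodic face lift of the defect -/

/-- **THE CORRECTION.**  For unitary `(L·M)`-periodic `V` in `SmallField V a`, `liftSmall d L·a ≤ 1`, a skew `M`-periodic coarse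
datum `φ` and ANY skew `(L·M)`-periodic fine direction `ψ₀`, there is a face-supported, skew, `(L·M)`-periodic `η` with
`pushDir L V (ψ₀ + η) (L•y) κ = φ y κ` for all coarse bonds (EXACT lift) and `‖η(b₀(c))‖ ≤ 2L^d·‖φ(c) − cpush L V ψ₀ (c)‖`
(the periodic face lift of the defect, `exists_lift_periodic`; exactness by additivity `pushDir_add`). [folklore] -/
theorem exists_correction {L : ℕ} (hL : 1 ≤ L) {M : ℕ} {V : Site d → Fin d → (Matrix n n ℂ)ˣ} (hV : IsUnitaryCfg V)
    (hVP : IsPeriodicCfg V ((L : ℤ) * M)) {a : ℝ} (ha : 0 ≤ a) (hsmall : liftSmall d L * a ≤ 1) (hVa : SmallField V a)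
    {φ : Site d → Fin d → Matrix n n ℂ} (hφs : ∀ (y : Site d) (κ : Fin d), φ y κ ∈ skewAdjoint (Matrix n n ℂ))
    (hφP : IsPeriodicDir φ (M : ℤ)) {ψ₀ : Site d → Fin d → Matrix n n ℂ} (hψ₀s : IsSkewDir ψ₀)
    (hψ₀P : IsPeriodicDir ψ₀ ((L : ℤ) * M)) :
    ∃ η : Site d → Fin d → Matrix n n ℂ, FaceSupported L η ∧ IsSkewDir η ∧ IsPeriodicDir η ((L : ℤ) * M) ∧
      (∀ (y : Site d) (κ : Fin d), pushDir L V (ψ₀ + η) ((L : ℤ) • y) κ = φ y κ) ∧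
      (∀ (y : Site d) (κ : Fin d), ‖η (faceSite L y κ) κ‖ ≤ 2 * (L : ℝ) ^ d * ‖φ y κ - cpush L V ψ₀ y κ‖) := by
  obtain ⟨η, hηF, hηP, hηpush, hηn, hηs⟩ := exists_lift_periodic hL hV hVP ha hsmall hVa
    (fun y κ => φ y κ - cpush L V ψ₀ y κ) (isPeriodicDir_defect hVP hφP hψ₀P)
  have hηskew : IsSkewDir η := hηs (defect_mem_skewAdjoint hL hV ha hsmall hVa hφs hψ₀s)
  refine ⟨η, hηF, hηskew, hηP, fun y κ => ?_, hηn⟩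
  rw [pushDir_add L V ψ₀ η _ κ (loop_le_of_liftSmall hL hV ha hsmall hVa _ κ), hηpush y κ]
  simp only [cpush, add_sub_cancel]

/-! ## §3 The correction's norms over one period against the defect's coarse norms -/

omit [Nonempty n] in
/-- `dirSq η ≤ (2L^d)²·coarseSq M δ` over one period for a face-supported `η` with `‖η(b₀(c))‖ ≤ 2L^d‖δ(c)‖`. [folklore] -/
theorem dirSq_le_of_faceBound {L : ℕ} (hL : 1 ≤ L) (M : ℕ) {η : Site d → Fin d → Matrix n n ℂ} (hηF : FaceSupported L η)
    {δ : Site d → Fin d → Matrix n n ℂ} (hηn : ∀ (y : Site d) (κ : Fin d), ‖η (faceSite L y κ) κ‖ ≤ 2 * (L : ℝ) ^ d * ‖δ y κ‖) :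
    dirSq η (periodBox (L * M)) ≤ (2 * (L : ℝ) ^ d) ^ 2 * coarseSq M δ := by
  rw [dirSq_faceSupported_eq hL M hηF, coarseSq, Finset.mul_sum]
  refine Finset.sum_le_sum fun y _ => ?_
  rw [Finset.mul_sum]
  refine Finset.sum_le_sum fun κ _ => ?_
  rw [← mul_pow]
  exact pow_le_pow_left₀ (norm_nonneg _) (hηn y κ) 2

omit [Nonempty n] in
/-- `dirL1 η ≤ 2L^d·coarseL1 M δ` over one period. [folklore] -/
theorem dirL1_le_of_faceBound {L : ℕ} (hL : 1 ≤ L) (M : ℕ) {η : Site d → Fin d → Matrix n n ℂ} (hηF : FaceSupported L η)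
    {δ : Site d → Fin d → Matrix n n ℂ} (hηn : ∀ (y : Site d) (κ : Fin d), ‖η (faceSite L y κ) κ‖ ≤ 2 * (L : ℝ) ^ d * ‖δ y κ‖) :
    dirL1 η (periodBox (L * M)) ≤ 2 * (L : ℝ) ^ d * coarseL1 M δ := by
  rw [dirL1_faceSupported_eq hL M hηF, coarseL1, Finset.mul_sum]
  refine Finset.sum_le_sum fun y _ => ?_
  rw [Finset.mul_sum]
  exact Finset.sum_le_sum fun κ _ => hηn y κ

omit [Nonempty n] in
/-- `curlSq V η ≤ 8·#Pl·(2L^d)²·coarseSq M δ` over one period (unitary `V`, periodic face-supported `η`, `L·M ≥ 1`). [folklore] -/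
theorem curlSq_le_of_faceBound {L : ℕ} (hL : 1 ≤ L) {M : ℕ} (hM : 1 ≤ M) {V : Site d → Fin d → (Matrix n n ℂ)ˣ}
    (hV : IsUnitaryCfg V) {η : Site d → Fin d → Matrix n n ℂ} (hηF : FaceSupported L η) (hηP : IsPeriodicDir η ((L : ℤ) * M))
    {δ : Site d → Fin d → Matrix n n ℂ} (hηn : ∀ (y : Site d) (κ : Fin d), ‖η (faceSite L y κ) κ‖ ≤ 2 * (L : ℝ) ^ d * ‖δ y κ‖) :
    curlSq V η (periodBox (L * M))
      ≤ 8 * Fintype.card (T4AveragingDeficitWall.Plane d) * ((2 * (L : ℝ) ^ d) ^ 2 * coarseSq M δ) := by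
  have hLM : 1 ≤ L * M := Nat.one_le_iff_ne_zero.mpr (Nat.mul_ne_zero (by omega) (by omega))
  have hηP' : IsPeriodicDir η ((L * M : ℕ) : ℤ) := by rw [natCast_mul_period]; exact hηP
  exact (curlSq_le_periodic hV hLM hηP').trans
    (mul_le_mul_of_nonneg_left (dirSq_le_of_faceBound hL M hηF hηn) (by positivity))

omit [Nonempty n] in
/-- `curlL1 V η ≤ 2·#Pl·(2L^d·coarseL1 M δ)` over one period. [folklore] -/
theorem curlL1_le_of_faceBound {L : ℕ} (hL : 1 ≤ L) {M : ℕ} (hM : 1 ≤ M) {V : Site d → Fin d → (Matrix n n ℂ)ˣ}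
    (hV : IsUnitaryCfg V) {η : Site d → Fin d → Matrix n n ℂ} (hηF : FaceSupported L η) (hηP : IsPeriodicDir η ((L : ℤ) * M))
    {δ : Site d → Fin d → Matrix n n ℂ} (hηn : ∀ (y : Site d) (κ : Fin d), ‖η (faceSite L y κ) κ‖ ≤ 2 * (L : ℝ) ^ d * ‖δ y κ‖) :
    curlL1 V η (periodBox (L * M))
      ≤ 2 * Fintype.card (T4AveragingDeficitWall.Plane d) * (2 * (L : ℝ) ^ d * coarseL1 M δ) := by
  have hLM : 1 ≤ L * M := Nat.one_le_iff_ne_zero.mpr (Nat.mul_ne_zero (by omega) (by omega))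
  have hηP' : IsPeriodicDir η ((L * M : ℕ) : ℤ) := by rw [natCast_mul_period]; exact hηP
  exact (curlL1_le_periodic hV hLM hηP').trans
    (mul_le_mul_of_nonneg_left (dirL1_le_of_faceBound hL M hηF hηn) (by positivity))

/-! ## §4 Minkowski ∕ triangle bookkeeping for `ψ₀ + η` -/

omit [Nonempty n] in
/-- Minkowski for the bond energy: `√dirSq (ψ₀ + η) F ≤ √dirSq ψ₀ F + √dirSq η F`. [folklore] -/
theorem sqrt_dirSq_add_le (ψ₀ η : Site d → Fin d → Matrix n n ℂ) (F : Finset (Site d)) :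
    Real.sqrt (dirSq (ψ₀ + η) F) ≤ Real.sqrt (dirSq ψ₀ F) + Real.sqrt (dirSq η F) := by
  unfold T4AveragingDeficitWall.dirSq
  rw [← Finset.sum_product (s := F) (t := Finset.univ) (f := fun p => ‖(ψ₀ + η) p.1 p.2‖ ^ 2),
    ← Finset.sum_product (s := F) (t := Finset.univ) (f := fun p => ‖ψ₀ p.1 p.2‖ ^ 2),
    ← Finset.sum_product (s := F) (t := Finset.univ) (f := fun p => ‖η p.1 p.2‖ ^ 2)]
  refine le_trans (Real.sqrt_le_sqrt (Finset.sum_le_sum fun p _ => ?_))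
    (sqrt_sum_sq_add_le (F ×ˢ Finset.univ) (fun p => ‖ψ₀ p.1 p.2‖) (fun p => ‖η p.1 p.2‖))
  have h := norm_add_le (ψ₀ p.1 p.2) (η p.1 p.2)
  have h0 : 0 ≤ ‖(ψ₀ + η) p.1 p.2‖ := norm_nonneg _
  simp only [Pi.add_apply] at h h0 ⊢
  nlinarith

omit [Nonempty n] in
/-- Minkowski for the curl energy: `√curlSq V (ψ₀ + η) F ≤ √curlSq V ψ₀ F + √curlSq V η F` (the dressed curl is additive,
`curlAt_add`). [folklore] -/
theorem sqrt_curlSq_add_le (V : Site d → Fin d → (Matrix n n ℂ)ˣ) (ψ₀ η : Site d → Fin d → Matrix n n ℂ)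
    (F : Finset (Site d)) :
    Real.sqrt (curlSq V (ψ₀ + η) F) ≤ Real.sqrt (curlSq V ψ₀ F) + Real.sqrt (curlSq V η F) := by
  rw [curlSq_eq_sum_plaqsOf, curlSq_eq_sum_plaqsOf, curlSq_eq_sum_plaqsOf]
  refine le_trans (Real.sqrt_le_sqrt (Finset.sum_le_sum fun p _ => ?_))
    (sqrt_sum_sq_add_le (plaqsOf F) (fun p => ‖curl V ψ₀ p‖) (fun p => ‖curl V η p‖))
  have hadd : curl V (ψ₀ + η) p = curl V ψ₀ p + curl V η p := curlAt_add V ψ₀ η p.1 p.2.1.1 p.2.1.2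
  have h := norm_add_le (curl V ψ₀ p) (curl V η p)
  have h0 : 0 ≤ ‖curl V (ψ₀ + η) p‖ := norm_nonneg _
  rw [hadd] at h0 ⊢
  nlinarith

omit [Nonempty n] in
/-- Triangle for the bond `ℓ¹` norm: `dirL1 (ψ₀ + η) F ≤ dirL1 ψ₀ F + dirL1 η F`. [folklore] -/
theorem dirL1_add_le (ψ₀ η : Site d → Fin d → Matrix n n ℂ) (F : Finset (Site d)) :
    dirL1 (ψ₀ + η) F ≤ dirL1 ψ₀ F + dirL1 η F := by
  unfold T4AveragingDeficitWall.dirL1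
  rw [← Finset.sum_add_distrib]
  refine Finset.sum_le_sum fun x _ => ?_
  rw [← Finset.sum_add_distrib]
  exact Finset.sum_le_sum fun κ _ => norm_add_le _ _

omit [Nonempty n] in
/-- Triangle for the curl `ℓ¹` norm: `curlL1 V (ψ₀ + η) F ≤ curlL1 V ψ₀ F + curlL1 V η F`. [folklore] -/
theorem curlL1_add_le (V : Site d → Fin d → (Matrix n n ℂ)ˣ) (ψ₀ η : Site d → Fin d → Matrix n n ℂ) (F : Finset (Site d)) :
    curlL1 V (ψ₀ + η) F ≤ curlL1 V ψ₀ F + curlL1 V η F := by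
  unfold T4AveragingDeficitWall.curlL1
  rw [← Finset.sum_add_distrib]
  refine Finset.sum_le_sum fun z _ => ?_
  rw [← Finset.sum_add_distrib]
  refine Finset.sum_le_sum fun π _ => ?_
  have hadd : curl V (ψ₀ + η) (z, π) = curl V ψ₀ (z, π) + curl V η (z, π) := curlAt_add V ψ₀ η z π.1.1 π.1.2
  rw [hadd]
  exact norm_add_le _ _

/-! ## §5 The ENDs -/

/-- **EXACTNESS BY DEFECT CORRECTION (R♯4).**  For `L, M ≥ 1`, unitary `(L·M)`-periodic `V` in `SmallField V a` with
`liftSmall d L·a ≤ 1`, a skew `M`-periodic coarse datum `φ`, and ANY skew `(L·M)`-periodic approximate lift `ψ₀` with push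
defect `δ = φ − cpush L V ψ₀`: there is an EXACT lift `ψ` (`pushDir L V ψ (L•y) κ = φ y κ`), skew and `(L·M)`-periodic, with
`ψ − ψ₀` face-supported and, over one period `F = [0, L·M)^d`,
`√curlSq V ψ F ≤ √curlSq V ψ₀ F + √(8#Pl)·2L^d·√coarseSq M δ`, `√dirSq ψ F ≤ √dirSq ψ₀ F + 2L^d·√coarseSq M δ`,
`dirL1 ψ F ≤ dirL1 ψ₀ F + 2L^d·coarseL1 M δ`, `curlL1 V ψ F ≤ curlL1 V ψ₀ F + 2#Pl·2L^d·coarseL1 M δ`. [folklore] -/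
theorem exists_exact_lift_of_approx {L : ℕ} (hL : 1 ≤ L) {M : ℕ} (hM : 1 ≤ M) {V : Site d → Fin d → (Matrix n n ℂ)ˣ}
    (hV : IsUnitaryCfg V) (hVP : IsPeriodicCfg V ((L : ℤ) * M)) {a : ℝ} (ha : 0 ≤ a) (hsmall : liftSmall d L * a ≤ 1)
    (hVa : SmallField V a) {φ : Site d → Fin d → Matrix n n ℂ} (hφs : ∀ (y : Site d) (κ : Fin d), φ y κ ∈ skewAdjoint (Matrix n n ℂ))
    (hφP : IsPeriodicDir φ (M : ℤ)) {ψ₀ : Site d → Fin d → Matrix n n ℂ} (hψ₀s : IsSkewDir ψ₀)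
    (hψ₀P : IsPeriodicDir ψ₀ ((L : ℤ) * M)) :
    ∃ ψ : Site d → Fin d → Matrix n n ℂ, IsSkewDir ψ ∧ IsPeriodicDir ψ ((L : ℤ) * M) ∧ FaceSupported L (ψ - ψ₀) ∧
      (∀ (y : Site d) (κ : Fin d), pushDir L V ψ ((L : ℤ) • y) κ = φ y κ) ∧
      Real.sqrt (curlSq V ψ (periodBox (L * M)))
        ≤ Real.sqrt (curlSq V ψ₀ (periodBox (L * M)))
          + Real.sqrt (8 * Fintype.card (T4AveragingDeficitWall.Plane d)) * (2 * (L : ℝ) ^ d)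
            * Real.sqrt (coarseSq M (fun y κ => φ y κ - cpush L V ψ₀ y κ)) ∧
      Real.sqrt (dirSq ψ (periodBox (L * M)))
        ≤ Real.sqrt (dirSq ψ₀ (periodBox (L * M)))
          + 2 * (L : ℝ) ^ d * Real.sqrt (coarseSq M (fun y κ => φ y κ - cpush L V ψ₀ y κ)) ∧
      dirL1 ψ (periodBox (L * M))
        ≤ dirL1 ψ₀ (periodBox (L * M)) + 2 * (L : ℝ) ^ d * coarseL1 M (fun y κ => φ y κ - cpush L V ψ₀ y κ) ∧
      curlL1 V ψ (periodBox (L * M))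
        ≤ curlL1 V ψ₀ (periodBox (L * M))
          + 2 * Fintype.card (T4AveragingDeficitWall.Plane d) * (2 * (L : ℝ) ^ d
            * coarseL1 M (fun y κ => φ y κ - cpush L V ψ₀ y κ)) := by
  obtain ⟨η, hηF, hηs, hηP, hpush, hηn⟩ := exists_correction hL hV hVP ha hsmall hVa hφs hφP hψ₀s hψ₀P
  set δ : Site d → Fin d → Matrix n n ℂ := fun y κ => φ y κ - cpush L V ψ₀ y κ with hδ
  set F : Finset (Site d) := periodBox (L * M) with hF
  have hcs0 : 0 ≤ coarseSq M δ := coarseSq_nonneg M δ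
  have hLd : 0 ≤ 2 * (L : ℝ) ^ d := by positivity
  -- the correction's norms
  have hdirSq := dirSq_le_of_faceBound hL M hηF hηn
  have hdirL1 := dirL1_le_of_faceBound hL M hηF hηn
  have hcurlSq := curlSq_le_of_faceBound hL hM hV hηF hηP hηn
  have hcurlL1 := curlL1_le_of_faceBound hL hM hV hηF hηP hηn
  have hsqrt_dir : Real.sqrt (dirSq η F) ≤ 2 * (L : ℝ) ^ d * Real.sqrt (coarseSq M δ) := by
    calc Real.sqrt (dirSq η F) ≤ Real.sqrt ((2 * (L : ℝ) ^ d) ^ 2 * coarseSq M δ) := Real.sqrt_le_sqrt hdirSq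
      _ = 2 * (L : ℝ) ^ d * Real.sqrt (coarseSq M δ) := by
          rw [Real.sqrt_mul (sq_nonneg _), Real.sqrt_sq hLd]
  have hsqrt_curl : Real.sqrt (curlSq V η F)
      ≤ Real.sqrt (8 * Fintype.card (T4AveragingDeficitWall.Plane d)) * (2 * (L : ℝ) ^ d) * Real.sqrt (coarseSq M δ) := by
    have h8 : (0 : ℝ) ≤ 8 * Fintype.card (T4AveragingDeficitWall.Plane d) := by positivity
    calc Real.sqrt (curlSq V η F)
        ≤ Real.sqrt (8 * Fintype.card (T4AveragingDeficitWall.Plane d) * ((2 * (L : ℝ) ^ d) ^ 2 * coarseSq M δ)) :=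
          Real.sqrt_le_sqrt hcurlSq
      _ = Real.sqrt (8 * Fintype.card (T4AveragingDeficitWall.Plane d)) * (2 * (L : ℝ) ^ d) * Real.sqrt (coarseSq M δ) := by
          rw [Real.sqrt_mul h8, Real.sqrt_mul (sq_nonneg _), Real.sqrt_sq hLd]; ring
  refine ⟨ψ₀ + η, fun x κ => (skewAdjoint _).add_mem (hψ₀s x κ) (hηs x κ), fun x j κ => ?_, ?_, hpush, ?_, ?_, ?_, ?_⟩
  · simp only [Pi.add_apply, hψ₀P x j κ, hηP x j κ]
  · simpa only [add_sub_cancel_left] using hηF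
  · exact (sqrt_curlSq_add_le V ψ₀ η F).trans (by linarith)
  · exact (sqrt_dirSq_add_le ψ₀ η F).trans (by linarith)
  · exact (dirL1_add_le ψ₀ η F).trans (by linarith)
  · exact (curlL1_add_le V ψ₀ η F).trans (by linarith)

omit [Nonempty n] in
/-- The defect's coarse norms under R♯3a's push-defect hypothesis `‖δ(c)‖ ≤ C₁·a·‖φ(c)‖`: `coarseSq M δ ≤ (C₁a)²·coarseSq M φ` and
`coarseL1 M δ ≤ C₁a·coarseL1 M φ`. [folklore] -/
theorem coarse_norms_of_pushDefect (M : ℕ) {φ δ : Site d → Fin d → Matrix n n ℂ} {C₁ a : ℝ}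
    (hdef : ∀ (y : Site d) (κ : Fin d), ‖δ y κ‖ ≤ C₁ * a * ‖φ y κ‖) :
    coarseSq M δ ≤ (C₁ * a) ^ 2 * coarseSq M φ ∧ coarseL1 M δ ≤ C₁ * a * coarseL1 M φ := by
  constructor
  · rw [coarseSq, coarseSq, Finset.mul_sum]
    refine Finset.sum_le_sum fun y _ => ?_
    rw [Finset.mul_sum]
    refine Finset.sum_le_sum fun κ _ => ?_
    rw [← mul_pow]
    exact pow_le_pow_left₀ (norm_nonneg _) (hdef y κ) 2
  · rw [coarseL1, coarseL1, Finset.mul_sum]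
    refine Finset.sum_le_sum fun y _ => ?_
    rw [Finset.mul_sum]
    exact Finset.sum_le_sum fun κ _ => hdef y κ

/-- **EXACTNESS BY DEFECT CORRECTION, a-WEIGHTED (R♯4 with R♯3a's HYPOTHESIS SHAPE).**  If the approximate lift's push defect
obeys `‖φ(c) − cpush L V ψ₀ (c)‖ ≤ C₁·a·‖φ(c)‖` (`0 ≤ C₁`; the dressed slice lift of R♯3a is the intended `ψ₀`), then the exact
lift `ψ` of `exists_exact_lift_of_approx` satisfies, over one period `F = [0, L·M)^d`,
`√curlSq V ψ F ≤ √curlSq V ψ₀ F + √(8#Pl)·2L^d·C₁·a·√coarseSq M φ`, `√dirSq ψ F ≤ √dirSq ψ₀ F + 2L^d·C₁·a·√coarseSq M φ`,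
`dirL1 ψ F ≤ dirL1 ψ₀ F + 2L^d·C₁·a·coarseL1 M φ`, `curlL1 V ψ F ≤ curlL1 V ψ₀ F + 2#Pl·2L^d·C₁·a·coarseL1 M φ` — the
«a-weighted, harmless» correction terms of the owner's cut. [folklore] -/
theorem exists_exact_lift_of_pushDefect {L : ℕ} (hL : 1 ≤ L) {M : ℕ} (hM : 1 ≤ M) {V : Site d → Fin d → (Matrix n n ℂ)ˣ}
    (hV : IsUnitaryCfg V) (hVP : IsPeriodicCfg V ((L : ℤ) * M)) {a : ℝ} (ha : 0 ≤ a) (hsmall : liftSmall d L * a ≤ 1)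
    (hVa : SmallField V a) {φ : Site d → Fin d → Matrix n n ℂ} (hφs : ∀ (y : Site d) (κ : Fin d), φ y κ ∈ skewAdjoint (Matrix n n ℂ))
    (hφP : IsPeriodicDir φ (M : ℤ)) {ψ₀ : Site d → Fin d → Matrix n n ℂ} (hψ₀s : IsSkewDir ψ₀)
    (hψ₀P : IsPeriodicDir ψ₀ ((L : ℤ) * M)) {C₁ : ℝ} (hC₁ : 0 ≤ C₁)
    (hdef : ∀ (y : Site d) (κ : Fin d), ‖φ y κ - cpush L V ψ₀ y κ‖ ≤ C₁ * a * ‖φ y κ‖) :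
    ∃ ψ : Site d → Fin d → Matrix n n ℂ, IsSkewDir ψ ∧ IsPeriodicDir ψ ((L : ℤ) * M) ∧ FaceSupported L (ψ - ψ₀) ∧
      (∀ (y : Site d) (κ : Fin d), pushDir L V ψ ((L : ℤ) • y) κ = φ y κ) ∧
      Real.sqrt (curlSq V ψ (periodBox (L * M)))
        ≤ Real.sqrt (curlSq V ψ₀ (periodBox (L * M)))
          + Real.sqrt (8 * Fintype.card (T4AveragingDeficitWall.Plane d)) * (2 * (L : ℝ) ^ d) * (C₁ * a)
            * Real.sqrt (coarseSq M φ) ∧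
      Real.sqrt (dirSq ψ (periodBox (L * M)))
        ≤ Real.sqrt (dirSq ψ₀ (periodBox (L * M))) + 2 * (L : ℝ) ^ d * (C₁ * a) * Real.sqrt (coarseSq M φ) ∧
      dirL1 ψ (periodBox (L * M)) ≤ dirL1 ψ₀ (periodBox (L * M)) + 2 * (L : ℝ) ^ d * (C₁ * a) * coarseL1 M φ ∧
      curlL1 V ψ (periodBox (L * M))
        ≤ curlL1 V ψ₀ (periodBox (L * M))
          + 2 * Fintype.card (T4AveragingDeficitWall.Plane d) * (2 * (L : ℝ) ^ d * ((C₁ * a) * coarseL1 M φ)) := by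
  obtain ⟨ψ, hψs, hψP, hψF, hpush, hc2, hd2, hd1, hc1⟩ :=
    exists_exact_lift_of_approx hL hM hV hVP ha hsmall hVa hφs hφP hψ₀s hψ₀P
  have hCa : 0 ≤ C₁ * a := mul_nonneg hC₁ ha
  obtain ⟨hSq, hL1⟩ := coarse_norms_of_pushDefect M hdef
  have hsq : Real.sqrt (coarseSq M (fun y κ => φ y κ - cpush L V ψ₀ y κ)) ≤ C₁ * a * Real.sqrt (coarseSq M φ) := by
    calc Real.sqrt (coarseSq M (fun y κ => φ y κ - cpush L V ψ₀ y κ))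
        ≤ Real.sqrt ((C₁ * a) ^ 2 * coarseSq M φ) := Real.sqrt_le_sqrt hSq
      _ = C₁ * a * Real.sqrt (coarseSq M φ) := by rw [Real.sqrt_mul (sq_nonneg _), Real.sqrt_sq hCa]
  have h8 : 0 ≤ Real.sqrt (8 * Fintype.card (T4AveragingDeficitWall.Plane d)) * (2 * (L : ℝ) ^ d) := by positivity
  have hLd : 0 ≤ 2 * (L : ℝ) ^ d := by positivity
  have hPl : (0 : ℝ) ≤ 2 * Fintype.card (T4AveragingDeficitWall.Plane d) := by positivity
  refine ⟨ψ, hψs, hψP, hψF, hpush, ?_, ?_, ?_, ?_⟩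
  · have := mul_le_mul_of_nonneg_left hsq h8
    linarith
  · have := mul_le_mul_of_nonneg_left hsq hLd
    linarith
  · have := mul_le_mul_of_nonneg_left hL1 hLd
    linarith
  · have := mul_le_mul_of_nonneg_left (mul_le_mul_of_nonneg_left hL1 hLd) hPl
    linarith

end

end Summit.QuantumFields.BalabanUV.T4Continuum.NE3LiftDefectCorrection
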